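import Literature.Probability.LatticeModels.PlaneRotatorTwistDuality
import Mathlib.Algebra.Order.Field.GeomSum
import Mathlib.Analysis.SpecificLimits.Normed
import HarnessLib

/-!
# High-temperature vanishing of the finite-volume helicity modulus of the plane rotator on `(ℤ/Lℤ)²`:
# `βΥ_L(K) ≤ 32·L⁶·(2K)^L` for `K ≤ ¼`, `L ≥ 10` — a Peierls argument in the current representation

Topic `Literature/Probability/LatticeModels`; companion of `PlaneRotatorTwistDuality.lean` (p542106:
`βΥ_L(K)·Z_L(K) = ∑_{n closed} ∏_b I_{n_b}(K)·w(n)²`, the helicity modulus as the winding-number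
variance of the dual ensemble of divergence-free integer currents `n` on the bonds of `(ℤ/Lℤ)²`) and
of `PlaneRotatorTwistInequality.lean` (p539386: the window `0 ≤ βΥ_L(K) ≤ 8K²/(1+8K)`). Everything is
PROVED; the definitions are combinatorial bookkeeping (arcs, codes of closed walks); no named fact.

## The argument

A closed current `n` with winding `w(n) ≠ 0` crosses every one of the `L` vertical cuts, so it
carries at least `L` units of `|n|` — but to turn this into a bound on `⟨w²⟩` one must factor the
winding part out of `n` without touching the rest (the entropy of all closed currents is extensive).
PEIERLS MAP: every nonzero closed current dominates a CONFORMAL CYCLE `c` (values `±1` with the sign of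
`n`, `|n_b| ≥ 1` on its support, closed) — follow the flow: Kirchhoff's law lets a walk along arcs
carrying current always continue, the finite set of flowing arcs forces a period, and the least
period has pairwise distinct bonds (§3); by strong induction on `|n|₁` (windings add up) some such
cycle has `w(c) ≠ 0`, hence `|c|₁ ≥ L` (§4–§5). Removing it costs `∏_b I_{n_b}(K) ≤ (K/2)^{|c|₁}
∏_b I_{(n−c)_b}(K)` (`I_m ≤ (K/2m) I_{m−1}`, §6) and `w(n)² ≤ 2w(n−c)² + 2|c|₁²`. Coding the cycle by
its start and its `ℓ` steps (`L²·4^ℓ` codes of length `ℓ`) and summing over all codes instead of the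
chosen one (all terms are nonnegative; the shift `n ↦ n − c` preserves the sum over `ℤ^{bonds}`)
gives the RENEWAL INEQUALITY `S ≤ 2ε₁S + 2ε₂Z` for `S = ∑_n W(n)w(n)²`, `Z = ∑_n W(n)`,
`ε₁ = L²∑_{ℓ=L}^{2L²}(2K)^ℓ`, `ε₂ = L²∑_{ℓ=L}^{2L²} ℓ²(2K)^ℓ` (§7), whence `βΥ_L = S/Z ≤ 4ε₂` as soon
as `ε₁ ≤ ¼`.

## Contents

* §1–§2 `TorusCurrent.*`: arcs (`arcBond`, `arcHead`, `arcSgn`, `arcCur`), `Flows`, `Kirchhoff`,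
  `wind` (flux through the cut at column `0`), `l1`; flow continuation `exists_flows_from`.
* §3 `Conformal`; the successor `next` on flowing arcs, `exists_minimal_period` (pigeonhole + least
  period), the cycle current `cycleCur` with `kirchhoff_cycleCur`, `conformal_cycleCur`, `l1_cycleCur`,
  `period_le_card`.
* §4 Codes `codeStep/codeVert/codeArc/codeCur`, `natAbs_wind_codeCur_le` (`|w(c)| ≤ ℓ`),
  `Conformal.of_sub`, **`exists_winding_code`** (extraction of a winding conformal cycle code).
* §5 `kirchhoff_iff` (Kirchhoff ⇔ trivial twisted character, tree
  `BondSystem.twistChar_bondChar_diffChar_eq_one_iff`), **`le_l1_of_wind_ne_zero`** (`L ≤ |c|₁`, tree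
  `torusXY_cutFlux_eq`).
* §6 `besselI_le_half_mul_pred`, **`prod_besselI_le_pow_mul`** (the Peierls factor `(K/2)^{|c|₁}`).
* §7 `currentWeight`, `currentWeight_le_pow_mul`, **`currentWeight_mul_wind_sq_le_sum`** (pointwise
  Peierls inequality), **`renewal_inequality`**, **`torusXYStiffness_le_of_peierls`**
  (`ε₁ ≤ ¼ ⇒ βΥ_L(K) ≤ 4ε₂`), **`torusXYStiffness_le_highTemperature`**
  (`0 ≤ K ≤ ¼`, `L ≥ 10 ⇒ βΥ_L(K) ≤ 32·L⁶·(2K)^L`) and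
  **`tendsto_torusXYStiffness_highTemperature`** (`βΥ_{L}(K) → 0` as `L → ∞` for `0 ≤ K ≤ ¼`);
  appended: **`tendsto_torusXYStiffness_of_lt_half`** (`βΥ_L(K) → 0` for every `0 ≤ K < ½`, i.e.
  `T > 2J`: the entropy factor `ε₁ ≤ L²(2K)^L/(1 − 2K)` is eventually `≤ ¼`).

Reading (cell `pub/hubbard-tc`): the LOWER END of the kernel's stiffness window
`0 ≤ βΥ_L(K) ≤ 8K²/(1+8K)` is ATTAINED in the thermodynamic limit at high temperature (`K ≤ ¼`, i.e.
`T ≥ 4J`): there the stiffness-window hypothesis `Υ_L/J ≥ y₀ > 0` of the typing rule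
(`torusXY_not_uniform_decay_of_tendsto`, p537000) provably FAILS — its premise `Υ_L → 0` is a theorem —
so any statement with `Υ_L` in a decay exponent must carry a low-temperature hypothesis.

## What this is not

A high-temperature statement about the classical plane rotator only (`K ≤ ¼`); nothing about low
temperature (`Υ_∞ > 0`, Fröhlich–Spencer), the transition, vortices as such, or any quantum or
electronic model; no number of the cell's tables consumes it. The constants (`¼`, `10`, `32·L⁶`) are
what the crude counts give and are not optimised.

## References

* S. Friedli, Y. Velenik, *Statistical Mechanics of Lattice Systems*, CUP 2017, §3.7.2 (Peierls'
  argument: energy of a contour versus the number `≤ 4·3^{n−1}` of contours of length `n`).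
  [FriedliVelenik2017]
* J. Fröhlich, T. Spencer, Comm. Math. Phys. 83 (1982) 411, §2.3 (duality transformation to
  integer currents). [FrohlichSpencerCMP1982]
* J. Fröhlich, C.-E. Pfister, Comm. Math. Phys. 89 (1983) 303, Lemma 3.1 and the Remark after it
  (pp. 307–308: the twist free energy and the energy of a vortex winding around the cylinder).
  [FrohlichPfister1983]
* M. Abramowitz, I. Stegun, 9.6.10 (series of `I_ν`; the ratio bound `I_{m+1} ≤ (x/2(m+1)) I_m`).
  [AbramowitzStegun1964]

Tree: `torusXYStiffness_mul_partitionFnJ_eq_tsum_winding`, `torusXY_cutFlux_eq`,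
`BondSystem.summable_currentWeight(_mul_flux_sq)`, `BondSystem.partitionFnJ_eq_tsum_currentWeight`,
`BondSystem.twistChar_bondChar_diffChar_eq_one_iff`, `besselI_natCast_succ_le`, `torusXYStiffness_nonneg`.
Mathlib: `Finite.exists_ne_map_eq_of_infinite`, `Nat.find`, `Finset.sum_range_sub`, `Equiv.subRight`,
`Summable.tsum_finsetSum`, `geom_sum_Ico_le_of_lt_one`, `tendsto_pow_const_mul_const_pow_of_abs_lt_one`.
-/

noncomputable section

open MeasureTheory Finset Filter
open scoped BigOperators Topology

namespace Literature.Probability.LatticeModels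

namespace TorusCurrent

variable {L : ℕ} [NeZero L]

/-! ## §1 Arcs of the torus `(ℤ/Lℤ)²` and integer currents -/

/-- The unit vector `eᵢ` of the torus `(ℤ/Lℤ)²`. [cite: FrohlichSpencerCMP1982, §2.3 (duality transformation: divergence-free integer currents)] -/
def unit (i : Fin 2) : TorusSite 2 L := Pi.single i 1

/-- An ARC is an oriented bond: `(v, i, true)` runs from `v` to `v + eᵢ` along the bond `(v, i)`,
`(v, i, false)` runs from `v` to `v − eᵢ` along the bond `(v − eᵢ, i)`. Its underlying bond. [cite: FrohlichSpencerCMP1982, §2.3 (duality transformation: divergence-free integer currents)] -/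
def arcBond (a : TorusSite 2 L × Fin 2 × Bool) : TorusSite 2 L × Fin 2 :=
  if a.2.2 then (a.1, a.2.1) else (a.1 - unit a.2.1, a.2.1)

/-- The head (end point) of an arc. [cite: FrohlichSpencerCMP1982, §2.3 (duality transformation: divergence-free integer currents)] -/
def arcHead (a : TorusSite 2 L × Fin 2 × Bool) : TorusSite 2 L :=
  if a.2.2 then a.1 + unit a.2.1 else a.1 - unit a.2.1

/-- The sign of an arc relative to the orientation of its bond: `+1` forward, `−1` backward. [cite: FrohlichSpencerCMP1982, §2.3 (duality transformation: divergence-free integer currents)] -/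
def arcSgn (a : TorusSite 2 L × Fin 2 × Bool) : ℤ :=
  if a.2.2 then 1 else -1

/-- The unit current carried by an arc: `±1` on its bond, `0` elsewhere. [cite: FrohlichSpencerCMP1982, §2.3 (duality transformation: divergence-free integer currents)] -/
def arcCur (a : TorusSite 2 L × Fin 2 × Bool) (b : TorusSite 2 L × Fin 2) : ℤ :=
  if b = arcBond a then arcSgn a else 0

/-- The current `n` FLOWS along the arc `a`: `n ≥ 1` on a forward arc, `n ≤ −1` on a backward arc.
[cite: FrohlichSpencerCMP1982, §2.3 (duality transformation: divergence-free integer currents)] -/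
def Flows (n : TorusSite 2 L × Fin 2 → ℤ) (a : TorusSite 2 L × Fin 2 × Bool) : Prop :=
  1 ≤ arcSgn a * n (arcBond a)

/-- Kirchhoff's law at every site, in the form produced by `torusXY_kirchhoff`:
`∑_b ([b.1 + e_{b.2} = v] − [b.1 = v]) n_b = 0`. [cite: FrohlichSpencerCMP1982, §2.3 (duality transformation: divergence-free integer currents)] -/
def Kirchhoff (n : TorusSite 2 L × Fin 2 → ℤ) : Prop :=
  ∀ v : TorusSite 2 L, ∑ b : TorusSite 2 L × Fin 2,
    ((if b.1 + Pi.single b.2 1 = v then (1 : ℤ) else 0) - (if b.1 = v then 1 else 0)) * n b = 0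

/-- The winding number (flux through the vertical cut at column `0`):
`w(n) = ∑_{v : v₀ = 0} n_{(v, e₁)}`. [cite: FrohlichSpencerCMP1982, §2.3 (duality transformation: divergence-free integer currents)] -/
def wind (n : TorusSite 2 L × Fin 2 → ℤ) : ℤ :=
  ∑ v : TorusSite 2 L, if v 0 = 0 then n (v, 0) else 0

/-- The `ℓ¹`-norm `∑_b |n_b|` of a current. [cite: FrohlichSpencerCMP1982, §2.3 (duality transformation: divergence-free integer currents)] -/
def l1 (n : TorusSite 2 L × Fin 2 → ℤ) : ℕ :=
  ∑ b : TorusSite 2 L × Fin 2, (n b).natAbs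

/-! ### Elementary identities -/

omit [NeZero L] in
/-- `sgn(a)² = 1`. [folklore] -/
private theorem arcSgn_sq (a : TorusSite 2 L × Fin 2 × Bool) : arcSgn a * arcSgn a = 1 := by
  unfold arcSgn; split_ifs <;> simp

omit [NeZero L] in
/-- `|sgn(a)| = 1`. [folklore] -/
private theorem arcSgn_natAbs (a : TorusSite 2 L × Fin 2 × Bool) : (arcSgn a).natAbs = 1 := by
  unfold arcSgn; split_ifs <;> simp

omit [NeZero L] in
/-- `sgn(a) = ±1`. [folklore] -/
private theorem arcSgn_eq_or (a : TorusSite 2 L × Fin 2 × Bool) : arcSgn a = 1 ∨ arcSgn a = -1 := by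
  unfold arcSgn; split_ifs <;> simp

/-- The Kirchhoff functional of an arc current: `[head a = v] − [tail a = v]`. [folklore] -/
private theorem kirchhoffSum_arcCur (a : TorusSite 2 L × Fin 2 × Bool) (v : TorusSite 2 L) :
    ∑ b : TorusSite 2 L × Fin 2,
      ((if b.1 + Pi.single b.2 1 = v then (1 : ℤ) else 0) - (if b.1 = v then 1 else 0)) * arcCur a b =
      (if arcHead a = v then (1 : ℤ) else 0) - (if a.1 = v then 1 else 0) := by
  classical
  have h : ∀ b : TorusSite 2 L × Fin 2,
      ((if b.1 + Pi.single b.2 1 = v then (1 : ℤ) else 0) - (if b.1 = v then 1 else 0)) * arcCur a b =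
        if b = arcBond a then
          ((if b.1 + Pi.single b.2 1 = v then (1 : ℤ) else 0) - (if b.1 = v then 1 else 0)) * arcSgn a
        else 0 := fun b => by
    unfold arcCur; split_ifs <;> simp
  rw [Finset.sum_congr rfl fun b _ => h b, Finset.sum_ite_eq', if_pos (Finset.mem_univ _)]
  obtain ⟨u, i, s⟩ := a
  cases s <;> simp [arcBond, arcHead, arcSgn, unit, sub_add_cancel]

/-- Kirchhoff is additive. [cite: FrohlichSpencerCMP1982, §2.3 (duality transformation: divergence-free integer currents)] -/
theorem Kirchhoff.sub {n m : TorusSite 2 L × Fin 2 → ℤ} (hn : Kirchhoff n) (hm : Kirchhoff m) :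
    Kirchhoff (n - m) := fun v => by
  have e : ∀ b : TorusSite 2 L × Fin 2,
      ((if b.1 + Pi.single b.2 1 = v then (1 : ℤ) else 0) - (if b.1 = v then 1 else 0)) * (n - m) b =
      ((if b.1 + Pi.single b.2 1 = v then (1 : ℤ) else 0) - (if b.1 = v then 1 else 0)) * n b -
        ((if b.1 + Pi.single b.2 1 = v then (1 : ℤ) else 0) - (if b.1 = v then 1 else 0)) * m b :=
    fun b => by simp only [Pi.sub_apply]; ring
  simp only [e, Finset.sum_sub_distrib, hn v, hm v, sub_self]

/-- Winding is additive. [cite: FrohlichSpencerCMP1982, §2.3 (duality transformation: divergence-free integer currents)] -/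
theorem wind_sub (n m : TorusSite 2 L × Fin 2 → ℤ) : wind (n - m) = wind n - wind m := by
  unfold wind
  rw [← Finset.sum_sub_distrib]
  exact Finset.sum_congr rfl fun v _ => by split_ifs <;> simp

/-- `|w(n)| ≤ |n|₁`. [folklore] -/
private theorem natAbs_wind_le_l1 (n : TorusSite 2 L × Fin 2 → ℤ) : (wind n).natAbs ≤ l1 n := by
  unfold wind l1
  refine (Int.natAbs_sum_le _ _).trans ?_
  calc ∑ v : TorusSite 2 L, (if v 0 = 0 then n (v, 0) else 0).natAbs
      ≤ ∑ v : TorusSite 2 L, (n (v, 0)).natAbs := Finset.sum_le_sum fun v _ => by split_ifs <;> simp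
    _ = ∑ v : TorusSite 2 L, ∑ i : Fin 2, if i = 0 then (n (v, i)).natAbs else 0 := by simp
    _ ≤ ∑ v : TorusSite 2 L, ∑ i : Fin 2, (n (v, i)).natAbs :=
        Finset.sum_le_sum fun v _ => Finset.sum_le_sum fun i _ => by split_ifs <;> simp
    _ = ∑ b : TorusSite 2 L × Fin 2, (n b).natAbs :=
        (Fintype.sum_prod_type fun b : TorusSite 2 L × Fin 2 => (n b).natAbs).symm

/-! ## §2 Kirchhoff at a site: inflow equals outflow -/

/-- Kirchhoff's law at `v`, unfolded: `∑ᵢ (n_{(v − eᵢ, i)} − n_{(v, i)}) = 0`. [folklore] -/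
private theorem Kirchhoff.sum_dir {n : TorusSite 2 L × Fin 2 → ℤ} (hn : Kirchhoff n) (v : TorusSite 2 L) :
    ∑ i : Fin 2, (n (v - unit i, i) - n (v, i)) = 0 := by
  classical
  have h := hn v
  simp only [sub_mul, Finset.sum_sub_distrib, ite_mul, one_mul, zero_mul, Fintype.sum_prod_type] at h
  have h1 : ∀ i : Fin 2, (∑ u : TorusSite 2 L, if u + Pi.single i 1 = v then n (u, i) else 0) =
      n (v - unit i, i) := fun i => by
    have : ∀ u : TorusSite 2 L, (u + Pi.single i 1 = v) = (u = v - unit i) := fun u => by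
      rw [unit, eq_sub_iff_add_eq]
    simp only [this, Finset.sum_ite_eq', Finset.mem_univ, if_true]
  have h2 : ∀ i : Fin 2, (∑ u : TorusSite 2 L, if u = v then n (u, i) else 0) = n (v, i) := fun i => by
    rw [Finset.sum_ite_eq', if_pos (Finset.mem_univ _)]
  rw [Finset.sum_comm, Finset.sum_congr rfl fun i _ => h1 i] at h
  rw [Finset.sum_comm (f := fun u i => if u = v then n (u, i) else 0),
    Finset.sum_congr rfl fun i _ => h2 i] at h
  rw [Finset.sum_sub_distrib]
  exact h

/-- **Flow continuation**: if the closed current `n` flows along an arc INTO `v`, it flows along some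
arc OUT OF `v`. [cite: FrohlichSpencerCMP1982, §2.3 (duality transformation: divergence-free integer currents)] -/
theorem exists_flows_from {n : TorusSite 2 L × Fin 2 → ℤ} (hn : Kirchhoff n)
    {a : TorusSite 2 L × Fin 2 × Bool} (ha : Flows n a) :
    ∃ a' : TorusSite 2 L × Fin 2 × Bool, a'.1 = arcHead a ∧ Flows n a' := by
  by_contra hno
  push Not at hno
  set v := arcHead a with hv
  -- no arc out of `v` flows: all four bond values have the wrong sign
  have hfwd : ∀ i : Fin 2, n (v, i) ≤ 0 := fun i => by
    have h := hno (v, i, true) rfl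
    simp only [Flows, arcSgn, arcBond, if_true, one_mul, not_le] at h
    omega
  have hbwd : ∀ i : Fin 2, 0 ≤ n (v - unit i, i) := fun i => by
    have h := hno (v, i, false) rfl
    simp only [Flows, arcSgn, arcBond, Bool.false_eq_true, ↓reduceIte, not_le] at h
    omega
  have hk := hn.sum_dir v
  simp only [Fin.sum_univ_two] at hk
  have h0 : ∀ i : Fin 2, n (v, i) = 0 ∧ n (v - unit i, i) = 0 := by
    have := hfwd 0; have := hfwd 1; have := hbwd 0; have := hbwd 1
    intro i; fin_cases i <;> simp <;> omega
  -- but `a` flows into `v`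
  obtain ⟨u, i, s⟩ := a
  cases s with
  | true =>
    simp only [Flows, arcSgn, arcBond, if_true, one_mul] at ha
    simp only [arcHead, if_true] at hv
    have := (h0 i).2
    rw [hv, add_sub_cancel_right] at this
    omega
  | false =>
    simp only [Flows, arcSgn, arcBond, Bool.false_eq_true, ↓reduceIte, neg_mul, one_mul] at ha
    simp only [arcHead, Bool.false_eq_true, ↓reduceIte] at hv
    have := (h0 i).1
    rw [hv] at this
    omega

/-! ## §3 Conformal cycles: the flow-following walk -/

/-- A current `c` with values in `{0, ±1}` is CONFORMAL to `n`: wherever `c_b ≠ 0`, `n_b` has the same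
sign and `|n_b| ≥ 1`. [cite: FriedliVelenik2017, §3.7.2 (Peierls argument: contours, energy and entropy counting)] -/
def Conformal (c n : TorusSite 2 L × Fin 2 → ℤ) : Prop :=
  ∀ b, c b = 0 ∨ (c b = 1 ∧ 1 ≤ n b) ∨ (c b = -1 ∧ n b ≤ -1)

/-- Removing a conformal current lowers the `ℓ¹`-norm by exactly its own norm. [cite: FriedliVelenik2017, §3.7.2 (Peierls argument: contours, energy and entropy counting)] -/
theorem Conformal.l1_sub {c n : TorusSite 2 L × Fin 2 → ℤ} (h : Conformal c n) :
    l1 (n - c) + l1 c = l1 n := by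
  unfold l1
  rw [← Finset.sum_add_distrib]
  refine Finset.sum_congr rfl fun b _ => ?_
  simp only [Pi.sub_apply]
  rcases h b with h0 | ⟨h1, hn⟩ | ⟨h1, hn⟩
  · rw [h0]; simp
  · rw [h1]; omega
  · rw [h1]; omega

omit [NeZero L] in
/-- Two flowing arcs with the same bond coincide (the sign of `n` on the bond fixes the orientation,
the orientation fixes the tail). [cite: FrohlichSpencerCMP1982, §2.3 (duality transformation: divergence-free integer currents)] -/
theorem arc_eq_of_flows {n : TorusSite 2 L × Fin 2 → ℤ} {a a' : TorusSite 2 L × Fin 2 × Bool}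
    (ha : Flows n a) (ha' : Flows n a') (h : arcBond a = arcBond a') : a = a' := by
  obtain ⟨u, i, s⟩ := a
  obtain ⟨u', i', s'⟩ := a'
  have hb := h
  unfold arcBond at hb
  unfold Flows arcSgn at ha ha'
  rw [h] at ha
  cases s <;> cases s'
  · simp only [Bool.false_eq_true, ↓reduceIte, Prod.mk.injEq] at hb
    obtain ⟨hu, hi⟩ := hb
    subst hi
    have hu' : u = u' := sub_left_injective hu
    subst hu'
    rfl
  · exfalso
    simp only [Bool.false_eq_true, ↓reduceIte] at ha ha'
    omega
  · exfalso
    simp only [Bool.false_eq_true, ↓reduceIte] at ha ha'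
    omega
  · simp only [if_true, Prod.mk.injEq] at hb
    obtain ⟨hu, hi⟩ := hb
    subst hi
    subst hu
    rfl

section Walk

variable {n : TorusSite 2 L × Fin 2 → ℤ} (hn : Kirchhoff n)

/-- The flow-following successor: a flowing arc out of the head of a flowing arc. [cite: FriedliVelenik2017, §3.7.2 (Peierls argument: contours, energy and entropy counting)] -/
def next (a : {a : TorusSite 2 L × Fin 2 × Bool // Flows n a}) :
    {a : TorusSite 2 L × Fin 2 × Bool // Flows n a} :=
  ⟨Classical.choose (exists_flows_from hn a.2), (Classical.choose_spec (exists_flows_from hn a.2)).2⟩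

/-- The successor arc starts where the arc ends. [folklore] -/
private theorem next_tail (a : {a : TorusSite 2 L × Fin 2 × Bool // Flows n a}) :
    (next hn a).1.1 = arcHead a.1 :=
  (Classical.choose_spec (exists_flows_from hn a.2)).1

/-- Iterates of the successor: consecutive arcs are head-to-tail. [folklore] -/
private theorem iterate_next_tail (a : {a : TorusSite 2 L × Fin 2 × Bool // Flows n a}) (t : ℕ) :
    ((next hn)^[t + 1] a).1.1 = arcHead ((next hn)^[t] a).1 := by
  rw [Function.iterate_succ_apply']
  exact next_tail hn _

/-- **A periodic flowing arc with minimal period and pairwise distinct arcs along the period**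
(pigeonhole on the finite set of flowing arcs, then the least period). [cite: FriedliVelenik2017, §3.7.2 (Peierls argument: contours, energy and entropy counting)] -/
theorem exists_minimal_period (a₀ : {a : TorusSite 2 L × Fin 2 × Bool // Flows n a}) :
    ∃ a₁ : {a : TorusSite 2 L × Fin 2 × Bool // Flows n a}, ∃ p : ℕ, 0 < p ∧
      (next hn)^[p] a₁ = a₁ ∧
      ∀ i j, i < j → j < p → (next hn)^[i] a₁ ≠ (next hn)^[j] a₁ := by
  obtain ⟨k, m, hkm, heq⟩ := Finite.exists_ne_map_eq_of_infinite (fun k : ℕ => (next hn)^[k] a₀)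
  -- arrange `k < m`
  wlog hlt : k < m generalizing k m
  · exact this m k hkm.symm heq.symm (lt_of_le_of_ne (not_lt.1 hlt) hkm.symm)
  set a₁ := (next hn)^[k] a₀ with ha₁
  have hP : ∃ p, 0 < p ∧ (next hn)^[p] a₁ = a₁ := by
    refine ⟨m - k, Nat.sub_pos_of_lt hlt, ?_⟩
    rw [ha₁, ← Function.iterate_add_apply, Nat.sub_add_cancel hlt.le]
    exact heq.symm
  classical
  refine ⟨a₁, Nat.find hP, (Nat.find_spec hP).1, (Nat.find_spec hP).2, ?_⟩
  intro i j hij hjp hc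
  -- then `i + (p − j)` is a smaller positive period
  have hper : (next hn)^[i + (Nat.find hP - j)] a₁ = a₁ := by
    rw [add_comm, Function.iterate_add_apply, hc, ← Function.iterate_add_apply,
      Nat.sub_add_cancel hjp.le]
    exact (Nat.find_spec hP).2
  have hlt' : i + (Nat.find hP - j) < Nat.find hP := by omega
  exact Nat.find_min hP hlt' ⟨by omega, hper⟩

end Walk

/-! ### The cycle current of a periodic walk -/

section Cycle

variable {n : TorusSite 2 L × Fin 2 → ℤ} (hn : Kirchhoff n)
  (a₁ : {a : TorusSite 2 L × Fin 2 × Bool // Flows n a}) (p : ℕ)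

/-- The current of the closed walk `a₁, next a₁, …, next^{p-1} a₁`: the sum of its arc currents.
[cite: FriedliVelenik2017, §3.7.2 (Peierls argument: contours, energy and entropy counting)] -/
def cycleCur : TorusSite 2 L × Fin 2 → ℤ :=
  fun b => ∑ t ∈ Finset.range p, arcCur ((next hn)^[t] a₁).1 b

/-- The cycle current is closed when the walk closes up (`next^p a₁ = a₁`): telescoping of
`[head = v] − [tail = v]` along the walk. [cite: FriedliVelenik2017, §3.7.2 (Peierls argument: contours, energy and entropy counting)] -/
theorem kirchhoff_cycleCur (hper : (next hn)^[p] a₁ = a₁) : Kirchhoff (cycleCur hn a₁ p) := by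
  intro v
  have h : ∀ b : TorusSite 2 L × Fin 2,
      ((if b.1 + Pi.single b.2 1 = v then (1 : ℤ) else 0) - (if b.1 = v then 1 else 0)) *
        cycleCur hn a₁ p b =
      ∑ t ∈ Finset.range p,
        ((if b.1 + Pi.single b.2 1 = v then (1 : ℤ) else 0) - (if b.1 = v then 1 else 0)) *
          arcCur ((next hn)^[t] a₁).1 b := fun b => by
    unfold cycleCur; rw [Finset.mul_sum]
  simp_rw [h]
  rw [Finset.sum_comm]
  simp_rw [kirchhoffSum_arcCur]
  have htel : ∀ t, (if arcHead ((next hn)^[t] a₁).1 = v then (1 : ℤ) else 0) =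
      (if ((next hn)^[t + 1] a₁).1.1 = v then (1 : ℤ) else 0) := fun t => by
    rw [iterate_next_tail]
  simp_rw [htel]
  rw [Finset.sum_range_sub (fun t => if ((next hn)^[t] a₁).1.1 = v then (1 : ℤ) else 0), hper,
    Function.iterate_zero_apply, sub_self]

variable (hdist : ∀ i j, i < j → j < p → (next hn)^[i] a₁ ≠ (next hn)^[j] a₁)
include hdist

/-- Along a minimal period the bonds are pairwise distinct. [folklore] -/
private theorem arcBond_injOn : Set.InjOn (fun t => arcBond ((next hn)^[t] a₁).1) (Finset.range p : Set ℕ) := by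
  intro i hi j hj h
  have hij : (next hn)^[i] a₁ = (next hn)^[j] a₁ :=
    Subtype.ext (arc_eq_of_flows ((next hn)^[i] a₁).2 ((next hn)^[j] a₁).2 h)
  by_contra hne
  rcases lt_or_gt_of_ne hne with hlt | hlt
  · exact hdist i j hlt (Finset.mem_range.1 hj) hij
  · exact hdist j i hlt (Finset.mem_range.1 hi) hij.symm

/-- The value of the cycle current on a bond: `sgn(a_t)` on the bond of `a_t`, `0` off the walk.
[folklore] -/
private theorem cycleCur_apply_of_mem {t : ℕ} (ht : t < p) :
    cycleCur hn a₁ p (arcBond ((next hn)^[t] a₁).1) = arcSgn ((next hn)^[t] a₁).1 := by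
  unfold cycleCur arcCur
  rw [Finset.sum_eq_single t]
  · rw [if_pos rfl]
  · intro t' ht' hne
    rw [if_neg]
    intro h
    exact hne (arcBond_injOn hn a₁ p hdist ht' (Finset.mem_range.2 ht) h.symm)
  · intro h; exact absurd (Finset.mem_range.2 ht) h

omit hdist in
/-- Off the walk the cycle current vanishes. [folklore] -/
private theorem cycleCur_apply_of_not_mem {b : TorusSite 2 L × Fin 2}
    (hb : ∀ t < p, arcBond ((next hn)^[t] a₁).1 ≠ b) : cycleCur hn a₁ p b = 0 := by
  unfold cycleCur arcCur
  exact Finset.sum_eq_zero fun t ht => by rw [if_neg (fun h => hb t (Finset.mem_range.1 ht) h.symm)]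

/-- The cycle current is conformal to `n`. [cite: FriedliVelenik2017, §3.7.2 (Peierls argument: contours, energy and entropy counting)] -/
theorem conformal_cycleCur : Conformal (cycleCur hn a₁ p) n := by
  intro b
  by_cases hb : ∃ t < p, arcBond ((next hn)^[t] a₁).1 = b
  · obtain ⟨t, ht, rfl⟩ := hb
    rw [cycleCur_apply_of_mem hn a₁ p hdist ht]
    have hf : 1 ≤ arcSgn ((next hn)^[t] a₁).1 * n (arcBond ((next hn)^[t] a₁).1) :=
      ((next hn)^[t] a₁).2
    right
    rcases arcSgn_eq_or ((next hn)^[t] a₁).1 with h1 | h1 <;> rw [h1] at hf ⊢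
    · left; exact ⟨rfl, by omega⟩
    · right; exact ⟨rfl, by omega⟩
  · left
    push Not at hb
    exact cycleCur_apply_of_not_mem hn a₁ p hb

/-- The `ℓ¹`-norm of the cycle current is the period `p`. [cite: FriedliVelenik2017, §3.7.2 (Peierls argument: contours, energy and entropy counting)] -/
theorem l1_cycleCur : l1 (cycleCur hn a₁ p) = p := by
  classical
  unfold l1
  have himg : ∀ b : TorusSite 2 L × Fin 2, (cycleCur hn a₁ p b).natAbs =
      if b ∈ (Finset.range p).image (fun t => arcBond ((next hn)^[t] a₁).1) then 1 else 0 := fun b => by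
    split_ifs with hb
    · obtain ⟨t, ht, rfl⟩ := Finset.mem_image.1 hb
      rw [cycleCur_apply_of_mem hn a₁ p hdist (Finset.mem_range.1 ht), arcSgn_natAbs]
    · rw [cycleCur_apply_of_not_mem hn a₁ p fun t ht h => hb (Finset.mem_image.2 ⟨t, Finset.mem_range.2 ht, h⟩),
        Int.natAbs_zero]
  simp_rw [himg]
  rw [Finset.sum_ite_mem, Finset.univ_inter, Finset.sum_const, smul_eq_mul, mul_one,
    Finset.card_image_of_injOn (arcBond_injOn hn a₁ p hdist), Finset.card_range]

/-- The period is at most the number of bonds `2L²`. [cite: FriedliVelenik2017, §3.7.2 (Peierls argument: contours, energy and entropy counting)] -/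
theorem period_le_card : p ≤ 2 * L ^ 2 := by
  classical
  have h := Finset.card_le_card_of_injOn (fun t => arcBond ((next hn)^[t] a₁).1)
    (fun t _ => Finset.mem_univ _) (arcBond_injOn hn a₁ p hdist)
  simp only [Finset.card_range, Finset.card_univ, Fintype.card_prod, Fintype.card_fun, ZMod.card,
    Fintype.card_fin] at h
  linarith

end Cycle

/-! ## §4 Cycle codes and the extraction theorems -/

section Codes

/-- The `t`-th step of a code of length `ℓ` (junk `(0, true)` beyond `ℓ`). [cite: FriedliVelenik2017, §3.7.2 (Peierls argument: contours, energy and entropy counting)] -/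
def codeStep {ℓ : ℕ} (st : Fin ℓ → Fin 2 × Bool) (t : ℕ) : Fin 2 × Bool :=
  if h : t < ℓ then st ⟨t, h⟩ else (0, true)

/-- The walk of a code: `y₀ = v₀`, `y_{t+1} = head(y_t, step_t)`. [cite: FriedliVelenik2017, §3.7.2 (Peierls argument: contours, energy and entropy counting)] -/
def codeVert {ℓ : ℕ} (v₀ : TorusSite 2 L) (st : Fin ℓ → Fin 2 × Bool) : ℕ → TorusSite 2 L
  | 0 => v₀
  | t + 1 => arcHead (codeVert v₀ st t, codeStep st t)

/-- The `t`-th arc of a code. [cite: FriedliVelenik2017, §3.7.2 (Peierls argument: contours, energy and entropy counting)] -/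
def codeArc {ℓ : ℕ} (v₀ : TorusSite 2 L) (st : Fin ℓ → Fin 2 × Bool) (t : ℕ) :
    TorusSite 2 L × Fin 2 × Bool :=
  (codeVert v₀ st t, codeStep st t)

/-- The current of a code: the sum of the arc currents of its walk. [cite: FriedliVelenik2017, §3.7.2 (Peierls argument: contours, energy and entropy counting)] -/
def codeCur {ℓ : ℕ} (v₀ : TorusSite 2 L) (st : Fin ℓ → Fin 2 × Bool) : TorusSite 2 L × Fin 2 → ℤ :=
  fun b => ∑ t ∈ Finset.range ℓ, arcCur (codeArc v₀ st t) b

/-- An arc current has `ℓ¹`-norm one. [folklore] -/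
private theorem l1_arcCur (a : TorusSite 2 L × Fin 2 × Bool) :
    ∑ b : TorusSite 2 L × Fin 2, (arcCur a b).natAbs = 1 := by
  classical
  have h : ∀ b : TorusSite 2 L × Fin 2, (arcCur a b).natAbs = if b = arcBond a then 1 else 0 := fun b => by
    unfold arcCur; split_ifs <;> simp [arcSgn_natAbs]
  simp_rw [h]
  rw [Finset.sum_ite_eq', if_pos (Finset.mem_univ _)]

/-- The `ℓ¹`-norm of a code current is at most the code length. [folklore] -/
private theorem l1_codeCur_le {ℓ : ℕ} (v₀ : TorusSite 2 L) (st : Fin ℓ → Fin 2 × Bool) :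
    l1 (codeCur v₀ st) ≤ ℓ := by
  unfold l1 codeCur
  calc ∑ b : TorusSite 2 L × Fin 2, (∑ t ∈ Finset.range ℓ, arcCur (codeArc v₀ st t) b).natAbs
      ≤ ∑ b : TorusSite 2 L × Fin 2, ∑ t ∈ Finset.range ℓ, (arcCur (codeArc v₀ st t) b).natAbs :=
        Finset.sum_le_sum fun b _ => Int.natAbs_sum_le _ _
    _ = ∑ t ∈ Finset.range ℓ, ∑ b : TorusSite 2 L × Fin 2, (arcCur (codeArc v₀ st t) b).natAbs :=
        Finset.sum_comm
    _ = ℓ := by simp [l1_arcCur]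

/-- `|w(c)| ≤ ℓ` for the current of a code of length `ℓ`. [cite: FriedliVelenik2017, §3.7.2 (Peierls argument: contours, energy and entropy counting)] -/
theorem natAbs_wind_codeCur_le {ℓ : ℕ} (v₀ : TorusSite 2 L) (st : Fin ℓ → Fin 2 × Bool) :
    (wind (codeCur v₀ st)).natAbs ≤ ℓ :=
  (natAbs_wind_le_l1 _).trans (l1_codeCur_le v₀ st)

variable {n : TorusSite 2 L × Fin 2 → ℤ} (hn : Kirchhoff n)

/-- The code of a periodic flow-following walk reproduces its arcs. [folklore] -/
private theorem codeArc_eq_iterate (a₁ : {a : TorusSite 2 L × Fin 2 × Bool // Flows n a}) (p : ℕ)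
    {t : ℕ} (ht : t < p) :
    codeArc a₁.1.1 (fun t : Fin p => ((next hn)^[t.1] a₁).1.2) t = ((next hn)^[t] a₁).1 := by
  have hstep : ∀ t < p, codeStep (fun t : Fin p => ((next hn)^[t.1] a₁).1.2) t = ((next hn)^[t] a₁).1.2 :=
    fun t ht => by unfold codeStep; rw [dif_pos ht]
  have hvert : ∀ t ≤ p, codeVert a₁.1.1 (fun t : Fin p => ((next hn)^[t.1] a₁).1.2) t =
      ((next hn)^[t] a₁).1.1 := by
    intro t
    induction t with
    | zero => intro _; rfl
    | succ t ih =>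
      intro h
      show arcHead (codeVert a₁.1.1 _ t, codeStep _ t) = _
      rw [ih (Nat.le_of_succ_le h), hstep t (Nat.lt_of_succ_le h), iterate_next_tail]
  unfold codeArc
  rw [hvert t ht.le, hstep t ht]

/-- Hence the code current is the cycle current. [folklore] -/
private theorem codeCur_eq_cycleCur (a₁ : {a : TorusSite 2 L × Fin 2 × Bool // Flows n a}) (p : ℕ) :
    codeCur a₁.1.1 (fun t : Fin p => ((next hn)^[t.1] a₁).1.2) = cycleCur hn a₁ p := by
  funext b
  unfold codeCur cycleCur
  exact Finset.sum_congr rfl fun t ht => by rw [codeArc_eq_iterate hn a₁ p (Finset.mem_range.1 ht)]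

omit [NeZero L] hn in
/-- A nonzero current flows along some arc. [folklore] -/
private theorem exists_flows_of_ne_zero {b : TorusSite 2 L × Fin 2} (h : n b ≠ 0) :
    ∃ a : TorusSite 2 L × Fin 2 × Bool, Flows n a := by
  rcases lt_or_gt_of_ne h with hlt | hgt
  · refine ⟨(b.1 + unit b.2, b.2, false), ?_⟩
    unfold Flows arcSgn arcBond
    simp only [Bool.false_eq_true, ↓reduceIte, add_sub_cancel_right, Prod.mk.eta]
    omega
  · refine ⟨(b.1, b.2, true), ?_⟩
    unfold Flows arcSgn arcBond
    simp only [if_true, Prod.mk.eta]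
    omega

omit [NeZero L] hn in
/-- Conformality is inherited through a conformal subtraction. [cite: FriedliVelenik2017, §3.7.2 (Peierls argument: contours, energy and entropy counting)] -/
theorem Conformal.of_sub {c c' : TorusSite 2 L × Fin 2 → ℤ} (hc : Conformal c n)
    (h : Conformal c' (n - c)) : Conformal c' n := by
  intro b
  have h1 := hc b
  have h2 := h b
  simp only [Pi.sub_apply] at h2
  omega

/-- **Extraction of a winding conformal cycle.** For every closed current `n` with nonzero winding
there is a cycle code whose current `c` is conformal to `n`, closed, of `ℓ¹`-norm equal to the code
length `ℓ ≤ 2L²`, and has nonzero winding (flow-following walk for one conformal cycle; strong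
induction on `|n|₁` until a winding cycle appears — the windings add up to `w(n) ≠ 0`). [cite: FriedliVelenik2017, §3.7.2 (Peierls argument: contours, energy and entropy counting)] -/
theorem exists_winding_code : ∀ (N : ℕ) (n : TorusSite 2 L × Fin 2 → ℤ), l1 n ≤ N → Kirchhoff n →
    wind n ≠ 0 → ∃ (ℓ : ℕ) (v₀ : TorusSite 2 L) (st : Fin ℓ → Fin 2 × Bool),
      Conformal (codeCur v₀ st) n ∧ Kirchhoff (codeCur v₀ st) ∧ l1 (codeCur v₀ st) = ℓ ∧
        wind (codeCur v₀ st) ≠ 0 ∧ ℓ ≤ 2 * L ^ 2 := by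
  intro N
  induction N with
  | zero =>
    intro n hN _ hw
    exfalso
    apply hw
    have h0 : ∀ b, n b = 0 := fun b => by
      have : (n b).natAbs = 0 := by
        have := Finset.single_le_sum (fun b _ => Nat.zero_le ((n b).natAbs)) (Finset.mem_univ b)
        unfold l1 at hN; omega
      exact Int.natAbs_eq_zero.1 this
    unfold wind
    exact Finset.sum_eq_zero fun v _ => by simp [h0]
  | succ N ih =>
    intro n hN hn hw
    -- `n ≠ 0`
    have hne : ∃ b, n b ≠ 0 := by
      by_contra hall
      push Not at hall
      apply hw
      unfold wind
      exact Finset.sum_eq_zero fun v _ => by simp [hall]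
    obtain ⟨b, hb⟩ := hne
    obtain ⟨a₀, ha₀⟩ := exists_flows_of_ne_zero hb
    obtain ⟨a₁, p, hp, hper, hdist⟩ := exists_minimal_period hn ⟨a₀, ha₀⟩
    have hconf := conformal_cycleCur hn a₁ p hdist
    have hkir := kirchhoff_cycleCur hn a₁ p hper
    have hl1 := l1_cycleCur hn a₁ p hdist
    have hle := period_le_card hn a₁ p hdist
    by_cases hwc : wind (cycleCur hn a₁ p) ≠ 0
    · refine ⟨p, a₁.1.1, fun t : Fin p => ((next hn)^[t.1] a₁).1.2, ?_, ?_, ?_, ?_, hle⟩ <;>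
        rw [codeCur_eq_cycleCur hn a₁ p]
      exacts [hconf, hkir, hl1, hwc]
    · push Not at hwc
      have hsub := hconf.l1_sub
      rw [hl1] at hsub
      have hN' : l1 (n - cycleCur hn a₁ p) ≤ N := by omega
      have hw' : wind (n - cycleCur hn a₁ p) ≠ 0 := by rwa [wind_sub, hwc, sub_zero]
      obtain ⟨ℓ, v₀, st, hc', hk', hl', hw'', hℓ⟩ := ih _ hN' (hn.sub hkir) hw'
      exact ⟨ℓ, v₀, st, hconf.of_sub hc', hk', hl', hw'', hℓ⟩

end Codes

/-! ## §5 Closed currents: Kirchhoff ⇔ trivial twisted character; winding cycles are long -/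

section Length

omit [NeZero L] in
/-- `diffChar X X` is the trivial character. [folklore] -/
private theorem diffChar_self' {V : Type*} (X : V) : diffChar X X = (1 : (V → Circle) →ₜ* Circle) := by
  ext θ
  simp [diffChar_apply]

/-- **Kirchhoff's law ⇔ the twisted character is trivial** (`∏_b χ_b^{n_b} = 1`), i.e. the closed
currents of the character expansion are exactly the divergence-free ones (tree
`BondSystem.twistChar_bondChar_diffChar_eq_one_iff`). [cite: FrohlichSpencerCMP1982, §2.3 (duality transformation: divergence-free integer currents)] -/
theorem kirchhoff_iff (n : TorusSite 2 L × Fin 2 → ℤ) :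
    Kirchhoff n ↔ twistChar (torusXY 2 L).bondChar 1 n = 1 := by
  classical
  have hsrc : ∀ b : TorusSite 2 L × Fin 2, (torusXY 2 L).src b = b.1 := fun _ => rfl
  have htgt : ∀ b : TorusSite 2 L × Fin 2, (torusXY 2 L).tgt b = b.1 + Pi.single b.2 1 := fun _ => rfl
  have h := (torusXY 2 L).twistChar_bondChar_diffChar_eq_one_iff (0 : TorusSite 2 L) 0 n
  rw [diffChar_self'] at h
  simp only [hsrc, htgt, sub_self, zero_add] at h
  exact ⟨fun hk => h.2 hk, fun ht => h.1 ht⟩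

/-- **A closed current with nonzero winding has `ℓ¹`-norm at least `L`**: every one of the `L`
vertical cuts carries the same nonzero flux (tree `torusXY_cutFlux_eq`), hence at least one unit of
`|n|` on an `e₁`-bond of each column. [cite: FrohlichSpencerCMP1982, §2.3 (duality transformation: divergence-free integer currents)] -/
theorem le_l1_of_wind_ne_zero {c : TorusSite 2 L × Fin 2 → ℤ} (hc : Kirchhoff c) (hw : wind c ≠ 0) :
    L ≤ l1 c := by
  classical
  have hcl := (kirchhoff_iff c).1 hc
  have hcut : ∀ j : ZMod L, 1 ≤ ∑ v : TorusSite 2 L, if v 0 = j then (c (v, 0)).natAbs else 0 := by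
    intro j
    have hj := torusXY_cutFlux_eq hcl j
    have hne : (∑ v : TorusSite 2 L, if v 0 = j then c (v, 0) else 0) ≠ 0 := by
      rw [hj]; exact hw
    have h1 : 1 ≤ (∑ v : TorusSite 2 L, if v 0 = j then c (v, 0) else 0).natAbs :=
      Nat.one_le_iff_ne_zero.2 (Int.natAbs_ne_zero.2 hne)
    refine h1.trans ((Int.natAbs_sum_le _ _).trans (Finset.sum_le_sum fun v _ => ?_))
    split_ifs <;> simp
  calc L = ∑ _j : ZMod L, 1 := by rw [Finset.sum_const, Finset.card_univ, ZMod.card, smul_eq_mul, mul_one]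
    _ ≤ ∑ j : ZMod L, ∑ v : TorusSite 2 L, if v 0 = j then (c (v, 0)).natAbs else 0 :=
        Finset.sum_le_sum fun j _ => hcut j
    _ = ∑ v : TorusSite 2 L, (c (v, 0)).natAbs := by
        rw [Finset.sum_comm]
        exact Finset.sum_congr rfl fun v _ => by rw [Finset.sum_ite_eq, if_pos (Finset.mem_univ _)]
    _ ≤ ∑ v : TorusSite 2 L, ∑ i : Fin 2, (c (v, i)).natAbs :=
        Finset.sum_le_sum fun v _ => Finset.single_le_sum (f := fun i => (c (v, i)).natAbs)
          (fun i _ => Nat.zero_le _) (Finset.mem_univ (0 : Fin 2))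
    _ = l1 c := by unfold l1; rw [Fintype.sum_prod_type]

end Length

/-! ## §6 The Peierls map `n ↦ n − c`: `∏_b I_{n_b}(K) ≤ (K/2)^{|c|₁} ∏_b I_{(n−c)_b}(K)` -/

section Peierls

/-- Removing one unit of current from a bond costs a factor `K/2`: `I_m(K) ≤ (K/2)·I_{m−1}(K)` for
`m ≥ 1` (tree `besselI_natCast_succ_le`). [cite: AbramowitzStegun1964, 9.6.10 (series of `I_ν`; ratio bound)] -/
theorem besselI_le_half_mul_pred {K : ℝ} (hK : 0 ≤ K) {m : ℤ} (hm : 1 ≤ m) :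
    besselI m K ≤ K / 2 * besselI (m - 1) K := by
  obtain ⟨k, rfl⟩ : ∃ k : ℕ, m = (k : ℤ) + 1 := ⟨(m - 1).toNat, by omega⟩
  have h := besselI_natCast_succ_le hK k
  rw [show ((k : ℤ) + 1) = ((k + 1 : ℕ) : ℤ) by push_cast; ring,
    show (((k + 1 : ℕ) : ℤ) - 1) = (k : ℤ) by push_cast; ring]
  refine h.trans (mul_le_mul_of_nonneg_right ?_ (besselI_nonneg hK _))
  have hk1 : (1 : ℝ) ≤ (k : ℝ) + 1 := by linarith [Nat.cast_nonneg (α := ℝ) k]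
  exact div_le_div_of_nonneg_left hK (by norm_num) (by linarith)

omit [NeZero L] in
/-- Bondwise Peierls factor: for `c` conformal to `n`,
`I_{n_b}(K) ≤ (K/2 if c_b ≠ 0, else 1) · I_{(n−c)_b}(K)`. [cite: AbramowitzStegun1964, 9.6.10 (series of `I_ν`; ratio bound)] -/
private theorem besselI_le_peierls_factor {K : ℝ} (hK : 0 ≤ K) {c n : TorusSite 2 L × Fin 2 → ℤ}
    (h : Conformal c n) (b : TorusSite 2 L × Fin 2) :
    besselI (n b) K ≤ (if c b ≠ 0 then K / 2 else 1) * besselI ((n - c) b) K := by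
  simp only [Pi.sub_apply]
  rcases h b with h0 | ⟨h1, hn⟩ | ⟨h1, hn⟩
  · rw [h0]; simp
  · rw [h1, if_pos one_ne_zero]
    exact besselI_le_half_mul_pred hK hn
  · rw [h1, if_pos (by norm_num)]
    have e1 : besselI (n b) K = besselI (-(n b)) K := (besselI_neg_index _ _).symm
    have e2 : besselI (n b - -1) K = besselI (-(n b) - 1) K := by
      rw [← besselI_neg_index (n b - -1) K]; congr 1; ring
    rw [e1, e2]
    exact besselI_le_half_mul_pred hK (by omega)

/-- For a conformal current the number of bonds it occupies is its `ℓ¹`-norm. [cite: FriedliVelenik2017, §3.7.2 (Peierls argument: contours, energy and entropy counting)] -/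
private theorem card_support_eq_l1 {c n : TorusSite 2 L × Fin 2 → ℤ} (h : Conformal c n) :
    (Finset.univ.filter fun b : TorusSite 2 L × Fin 2 => c b ≠ 0).card = l1 c := by
  unfold l1
  rw [Finset.card_filter]
  refine Finset.sum_congr rfl fun b _ => ?_
  rcases h b with h0 | ⟨h1, _⟩ | ⟨h1, _⟩
  · simp [h0]
  · simp [h1]
  · simp [h1]

/-- **The Peierls bound** `∏_b I_{n_b}(K) ≤ (K/2)^{|c|₁} ∏_b I_{(n−c)_b}(K)` for `c` conformal to `n`
and `K ≥ 0`. [cite: AbramowitzStegun1964, 9.6.10 (series of `I_ν`; ratio bound)] -/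
theorem prod_besselI_le_pow_mul {K : ℝ} (hK : 0 ≤ K) {c n : TorusSite 2 L × Fin 2 → ℤ}
    (h : Conformal c n) :
    ∏ b : TorusSite 2 L × Fin 2, besselI (n b) K ≤
      (K / 2) ^ l1 c * ∏ b : TorusSite 2 L × Fin 2, besselI ((n - c) b) K := by
  classical
  calc ∏ b : TorusSite 2 L × Fin 2, besselI (n b) K
      ≤ ∏ b : TorusSite 2 L × Fin 2, (if c b ≠ 0 then K / 2 else 1) * besselI ((n - c) b) K :=
        Finset.prod_le_prod (fun b _ => besselI_nonneg hK _) fun b _ => besselI_le_peierls_factor hK h b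
    _ = (∏ b : TorusSite 2 L × Fin 2, (if c b ≠ 0 then K / 2 else (1 : ℝ))) *
          ∏ b : TorusSite 2 L × Fin 2, besselI ((n - c) b) K := Finset.prod_mul_distrib
    _ = (K / 2) ^ l1 c * ∏ b : TorusSite 2 L × Fin 2, besselI ((n - c) b) K := by
        rw [Finset.prod_ite, Finset.prod_const, Finset.prod_const_one, mul_one, card_support_eq_l1 h]

end Peierls

end TorusCurrent

/-! ## §7 The Peierls–renewal inequality and the high-temperature bound -/

section HighTemperature

open TorusCurrent

variable {L : ℕ} [NeZero L]

/-- The dual weight of an integer current on `(ℤ/Lℤ)²` at coupling `K`: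
`W_K(n) = [n closed] ∏_b I_{n_b}(K)` (the summand of the character expansion, as in
`PlaneRotatorTwistDuality.lean`). [cite: FrohlichSpencerCMP1982, §2.3 (duality transformation: integer currents)] -/
def currentWeight (K : ℝ) (n : TorusSite 2 L × Fin 2 → ℤ) : ℝ :=
  open Classical in
  if twistChar (torusXY 2 L).bondChar 1 n = 1 then ∏ b, besselI (n b) K else 0

/-- `W_K(n) ≥ 0` for `K ≥ 0`. [cite: FrohlichSpencerCMP1982, §2.3 (duality transformation: integer currents)] -/
theorem currentWeight_nonneg {K : ℝ} (hK : 0 ≤ K) (n : TorusSite 2 L × Fin 2 → ℤ) :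
    0 ≤ currentWeight K n := by
  unfold currentWeight
  split_ifs
  · exact prod_besselI_nonneg (fun _ => hK) n
  · exact le_rfl

/-- **The Peierls bound on the dual weights**: if `c = codeCur v₀ st` is conformal to the closed
current `n`, closed, with `|c|₁ = ℓ`, then `W_K(n) ≤ (K/2)^ℓ W_K(n − c)`. [cite: FriedliVelenik2017, §3.7.2 (Peierls argument: energy of a contour); AbramowitzStegun1964 9.6.10] -/
theorem currentWeight_le_pow_mul {K : ℝ} (hK : 0 ≤ K) {n c : TorusSite 2 L × Fin 2 → ℤ}
    (hn : Kirchhoff n) (hconf : Conformal c n) (hc : Kirchhoff c) :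
    currentWeight K n ≤ (K / 2) ^ l1 c * currentWeight K (n - c) := by
  unfold currentWeight
  rw [if_pos ((kirchhoff_iff n).1 hn), if_pos ((kirchhoff_iff _).1 (hn.sub hc))]
  exact prod_besselI_le_pow_mul hK hconf

/-- The winding number as a flux: `w(n) = ∑_b s_b n_b` with `s` the indicator of the `e₁`-bonds of
the column `0`. [folklore] -/
private theorem wind_eq_sum (n : TorusSite 2 L × Fin 2 → ℤ) :
    (wind n : ℝ) = ∑ b : TorusSite 2 L × Fin 2,
      (if b.2 = 0 ∧ b.1 0 = 0 then (1 : ℝ) else 0) * (n b : ℝ) := by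
  unfold wind
  push_cast
  rw [Fintype.sum_prod_type]
  refine Finset.sum_congr rfl fun v _ => ?_
  rw [Fin.sum_univ_two]
  by_cases hv : v 0 = 0 <;> simp [hv]

/-- Summability of `n ↦ W_K(n)`. [cite: FrohlichSpencerCMP1982, §2.3 (duality transformation)] -/
theorem summable_torusCurrentWeight (K : ℝ) :
    Summable fun n : TorusSite 2 L × Fin 2 → ℤ => currentWeight K n := by
  unfold currentWeight
  exact (torusXY 2 L).summable_currentWeight (fun _ => K)

/-- Summability of `n ↦ W_K(n) w(n)²`. [cite: FrohlichSpencerCMP1982, §2.3 (duality transformation)] -/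
theorem summable_torusCurrentWeight_mul_wind_sq (K : ℝ) :
    Summable fun n : TorusSite 2 L × Fin 2 → ℤ => currentWeight K n * (wind n : ℝ) ^ 2 := by
  have h := (torusXY 2 L).summable_currentWeight_mul_flux_sq (fun _ => K)
    (fun b : TorusSite 2 L × Fin 2 => if b.2 = 0 ∧ b.1 0 = 0 then (1 : ℝ) else 0)
  refine h.congr fun n => ?_
  unfold currentWeight
  rw [wind_eq_sum]

/-- **The pointwise Peierls inequality.** For `K ≥ 0` and every integer current `n`,
`W_K(n) w(n)² ≤ ∑_{ℓ=L}^{2L²} ∑_{codes (v₀, st) of length ℓ} (K/2)^ℓ · W_K(n − c) · (2 w(n − c)² + 2ℓ²)`,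
`c = codeCur v₀ st`: for a closed winding `n` the extracted winding cycle code is one of the terms
(`W_K(n) ≤ (K/2)^ℓ W_K(n−c)`, `w(n) = w(n−c) + w(c)`, `|w(c)| ≤ ℓ`, `L ≤ ℓ ≤ 2L²`); otherwise the left
side vanishes. [cite: FriedliVelenik2017, §3.7.2 (Peierls argument: energy-entropy bound)] -/
theorem currentWeight_mul_wind_sq_le_sum {K : ℝ} (hK : 0 ≤ K) (n : TorusSite 2 L × Fin 2 → ℤ) :
    currentWeight K n * (wind n : ℝ) ^ 2 ≤
      ∑ ℓ ∈ Finset.Icc L (2 * L ^ 2), ∑ p : TorusSite 2 L × (Fin ℓ → Fin 2 × Bool),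
        (K / 2) ^ ℓ * (currentWeight K (n - codeCur p.1 p.2) *
          (2 * (wind (n - codeCur p.1 p.2) : ℝ) ^ 2 + 2 * (ℓ : ℝ) ^ 2)) := by
  have hterm : ∀ (ℓ : ℕ) (p : TorusSite 2 L × (Fin ℓ → Fin 2 × Bool)),
      0 ≤ (K / 2) ^ ℓ * (currentWeight K (n - codeCur p.1 p.2) *
        (2 * (wind (n - codeCur p.1 p.2) : ℝ) ^ 2 + 2 * (ℓ : ℝ) ^ 2)) := fun ℓ p =>
    mul_nonneg (pow_nonneg (by linarith) _) (mul_nonneg (currentWeight_nonneg hK _) (by positivity))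
  have hrhs : 0 ≤ ∑ ℓ ∈ Finset.Icc L (2 * L ^ 2), ∑ p : TorusSite 2 L × (Fin ℓ → Fin 2 × Bool),
      (K / 2) ^ ℓ * (currentWeight K (n - codeCur p.1 p.2) *
        (2 * (wind (n - codeCur p.1 p.2) : ℝ) ^ 2 + 2 * (ℓ : ℝ) ^ 2)) :=
    Finset.sum_nonneg fun ℓ _ => Finset.sum_nonneg fun p _ => hterm ℓ p
  by_cases hcl : Kirchhoff n
  swap
  · have h0 : currentWeight K n = 0 := by
      unfold currentWeight; rw [if_neg (fun h => hcl ((kirchhoff_iff n).2 h))]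
    rw [h0, zero_mul]; exact hrhs
  by_cases hw : wind n = 0
  · rw [hw, Int.cast_zero, zero_pow two_ne_zero, mul_zero]; exact hrhs
  obtain ⟨ℓ, v₀, st, hconf, hkc, hl1, hwc, hℓ⟩ := exists_winding_code (l1 n) n le_rfl hcl hw
  have hL : L ≤ ℓ := hl1 ▸ le_l1_of_wind_ne_zero hkc hwc
  have hmem : ℓ ∈ Finset.Icc L (2 * L ^ 2) := Finset.mem_Icc.2 ⟨hL, hℓ⟩
  refine le_trans ?_ (Finset.single_le_sum (fun ℓ _ => Finset.sum_nonneg fun p _ => hterm ℓ p) hmem)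
  refine le_trans ?_ (Finset.single_le_sum (fun p _ => hterm ℓ p) (Finset.mem_univ (v₀, st)))
  set c := codeCur v₀ st with hcdef
  have hWle : currentWeight K n ≤ (K / 2) ^ ℓ * currentWeight K (n - c) := by
    rw [← hl1]; exact currentWeight_le_pow_mul hK hcl hconf hkc
  have hwc' : |(wind c : ℝ)| ≤ ℓ := by
    have h1 := natAbs_wind_le_l1 c
    rw [hl1] at h1
    have h2 : (|wind c| : ℤ) ≤ ℓ := by rw [← Int.natCast_natAbs]; exact_mod_cast h1
    rw [← Int.cast_abs]; exact_mod_cast h2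
  have hwsq : (wind n : ℝ) ^ 2 ≤ 2 * (wind (n - c) : ℝ) ^ 2 + 2 * (ℓ : ℝ) ^ 2 := by
    have hdec : (wind n : ℝ) = wind (n - c) + wind c := by rw [wind_sub]; push_cast; ring
    have hb : (wind c : ℝ) ^ 2 ≤ (ℓ : ℝ) ^ 2 := by
      have := abs_le.1 hwc'; nlinarith
    rw [hdec]
    nlinarith [sq_nonneg ((wind (n - c) : ℝ) - wind c)]
  calc currentWeight K n * (wind n : ℝ) ^ 2
      ≤ ((K / 2) ^ ℓ * currentWeight K (n - c)) * (2 * (wind (n - c) : ℝ) ^ 2 + 2 * (ℓ : ℝ) ^ 2) :=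
        mul_le_mul hWle hwsq (sq_nonneg _) (mul_nonneg (pow_nonneg (by linarith) _) (currentWeight_nonneg hK _))
    _ = _ := by rw [mul_assoc]

/-- Summability of the shifted family `n ↦ W_K(n − c)(2w(n − c)² + 2ℓ²)`. [cite: FrohlichSpencerCMP1982, §2.3 (duality transformation)] -/
private theorem summable_currentWeight_shift (K : ℝ) (c : TorusSite 2 L × Fin 2 → ℤ) (ℓ : ℕ) :
    Summable fun n : TorusSite 2 L × Fin 2 → ℤ =>
      currentWeight K (n - c) * (2 * (wind (n - c) : ℝ) ^ 2 + 2 * (ℓ : ℝ) ^ 2) := by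
  have h : Summable fun n : TorusSite 2 L × Fin 2 → ℤ =>
      currentWeight K n * (2 * (wind n : ℝ) ^ 2 + 2 * (ℓ : ℝ) ^ 2) := by
    have h1 := (summable_torusCurrentWeight_mul_wind_sq (L := L) K).mul_left 2
    have h2 := (summable_torusCurrentWeight (L := L) K).mul_left (2 * (ℓ : ℝ) ^ 2)
    refine (h1.add h2).congr fun n => ?_
    ring
  exact (Equiv.subRight c).summable_iff.2 h

/-- The shifted sum: `∑_n W_K(n − c)(2w(n − c)² + 2ℓ²) = 2S + 2ℓ²Z`. [cite: FrohlichSpencerCMP1982, §2.3 (duality transformation)] -/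
private theorem tsum_currentWeight_shift (K : ℝ) (c : TorusSite 2 L × Fin 2 → ℤ) (ℓ : ℕ) :
    ∑' n : TorusSite 2 L × Fin 2 → ℤ, currentWeight K (n - c) * (2 * (wind (n - c) : ℝ) ^ 2 + 2 * (ℓ : ℝ) ^ 2) =
      2 * (∑' n : TorusSite 2 L × Fin 2 → ℤ, currentWeight K n * (wind n : ℝ) ^ 2) +
        2 * (ℓ : ℝ) ^ 2 * ∑' n : TorusSite 2 L × Fin 2 → ℤ, currentWeight K n := by
  have hshift := (Equiv.subRight c).tsum_eq (fun n : TorusSite 2 L × Fin 2 → ℤ =>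
    currentWeight K n * (2 * (wind n : ℝ) ^ 2 + 2 * (ℓ : ℝ) ^ 2))
  simp only [Equiv.subRight_apply] at hshift
  rw [hshift]
  have h1 := (summable_torusCurrentWeight_mul_wind_sq (L := L) K).mul_left 2
  have h2 := (summable_torusCurrentWeight (L := L) K).mul_left (2 * (ℓ : ℝ) ^ 2)
  rw [← tsum_mul_left, ← tsum_mul_left, ← h1.tsum_add h2]
  exact tsum_congr fun n => by ring

/-- **The renewal inequality**: with `S = ∑_n W_K(n) w(n)²`, `Z = ∑_n W_K(n)`,
`ε₁ = L² ∑_{ℓ=L}^{2L²} (2K)^ℓ` and `ε₂ = L² ∑_{ℓ=L}^{2L²} ℓ²(2K)^ℓ` (number of codes of length `ℓ`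
`= L²·4^ℓ`, `4^ℓ (K/2)^ℓ = (2K)^ℓ`): `S ≤ 2ε₁ S + 2ε₂ Z`. [cite: FriedliVelenik2017, §3.7.2 (Peierls argument: energy-entropy bound)] -/
theorem renewal_inequality {K : ℝ} (hK : 0 ≤ K) :
    (∑' n : TorusSite 2 L × Fin 2 → ℤ, currentWeight K n * (wind n : ℝ) ^ 2) ≤
      2 * ((L : ℝ) ^ 2 * ∑ ℓ ∈ Finset.Icc L (2 * L ^ 2), (2 * K) ^ ℓ) *
          (∑' n : TorusSite 2 L × Fin 2 → ℤ, currentWeight K n * (wind n : ℝ) ^ 2) +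
        2 * ((L : ℝ) ^ 2 * ∑ ℓ ∈ Finset.Icc L (2 * L ^ 2), (ℓ : ℝ) ^ 2 * (2 * K) ^ ℓ) *
          ∑' n : TorusSite 2 L × Fin 2 → ℤ, currentWeight K n := by
  set S := ∑' n : TorusSite 2 L × Fin 2 → ℤ, currentWeight K n * (wind n : ℝ) ^ 2 with hS
  set Z := ∑' n : TorusSite 2 L × Fin 2 → ℤ, currentWeight K n with hZ
  -- sum the pointwise inequality
  have hsumm : ∀ ℓ (p : TorusSite 2 L × (Fin ℓ → Fin 2 × Bool)),
      Summable fun n : TorusSite 2 L × Fin 2 → ℤ => (K / 2) ^ ℓ * (currentWeight K (n - codeCur p.1 p.2) *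
        (2 * (wind (n - codeCur p.1 p.2) : ℝ) ^ 2 + 2 * (ℓ : ℝ) ^ 2)) :=
    fun ℓ p => (summable_currentWeight_shift K _ ℓ).mul_left _
  have hle := Summable.tsum_le_tsum (currentWeight_mul_wind_sq_le_sum (L := L) hK)
    (summable_torusCurrentWeight_mul_wind_sq K)
    (summable_sum fun ℓ _ => summable_sum fun p _ => hsumm ℓ p)
  refine hle.trans (le_of_eq ?_)
  rw [Summable.tsum_finsetSum fun ℓ _ => summable_sum fun p _ => hsumm ℓ p]
  have hinner : ∀ ℓ ∈ Finset.Icc L (2 * L ^ 2),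
      ∑' n : TorusSite 2 L × Fin 2 → ℤ, ∑ p : TorusSite 2 L × (Fin ℓ → Fin 2 × Bool),
        (K / 2) ^ ℓ * (currentWeight K (n - codeCur p.1 p.2) *
          (2 * (wind (n - codeCur p.1 p.2) : ℝ) ^ 2 + 2 * (ℓ : ℝ) ^ 2)) =
      (L : ℝ) ^ 2 * (2 * K) ^ ℓ * (2 * S + 2 * (ℓ : ℝ) ^ 2 * Z) := by
    intro ℓ _
    rw [Summable.tsum_finsetSum fun p _ => hsumm ℓ p]
    have hp : ∀ p : TorusSite 2 L × (Fin ℓ → Fin 2 × Bool),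
        ∑' n : TorusSite 2 L × Fin 2 → ℤ, (K / 2) ^ ℓ * (currentWeight K (n - codeCur p.1 p.2) *
          (2 * (wind (n - codeCur p.1 p.2) : ℝ) ^ 2 + 2 * (ℓ : ℝ) ^ 2)) =
        (K / 2) ^ ℓ * (2 * S + 2 * (ℓ : ℝ) ^ 2 * Z) := fun p => by
      rw [tsum_mul_left, tsum_currentWeight_shift]
    simp only [hp, Finset.sum_const, Finset.card_univ, Fintype.card_prod, Fintype.card_fun,
      Fintype.card_fin, Fintype.card_bool, ZMod.card]
    rw [nsmul_eq_mul]
    push_cast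
    have h4 : (4 : ℝ) ^ ℓ * (K / 2) ^ ℓ = (2 * K) ^ ℓ := by rw [← mul_pow]; congr 1; ring
    calc (L : ℝ) ^ 2 * 4 ^ ℓ * ((K / 2) ^ ℓ * (2 * S + 2 * (ℓ : ℝ) ^ 2 * Z))
        = (L : ℝ) ^ 2 * (4 ^ ℓ * (K / 2) ^ ℓ) * (2 * S + 2 * (ℓ : ℝ) ^ 2 * Z) := by ring
      _ = (L : ℝ) ^ 2 * (2 * K) ^ ℓ * (2 * S + 2 * (ℓ : ℝ) ^ 2 * Z) := by rw [h4]
  rw [Finset.sum_congr rfl hinner, Finset.mul_sum, Finset.mul_sum, Finset.mul_sum, Finset.mul_sum,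
    Finset.sum_mul, Finset.sum_mul, ← Finset.sum_add_distrib]
  exact Finset.sum_congr rfl fun ℓ _ => by ring

variable [MeasurableSpace Circle] [BorelSpace Circle]

/-- `βΥ_L(K) · Z_L(K) = ∑_n W_K(n) w(n)²` (the winding identity of `PlaneRotatorTwistDuality.lean` at
the cut `j = 0`) and `Z_L(K) = ∑_n W_K(n)`. [cite: FrohlichPfister1983, Lemma 3.1 and Remark (pp. 307–308)] -/
theorem torusXYStiffness_mul_partitionFnJ_eq_tsum_wind (K : ℝ) :
    torusXYStiffness L K * (torusXY 2 L).partitionFnJ (fun _ => K) =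
      ∑' n : TorusSite 2 L × Fin 2 → ℤ, currentWeight K n * (wind n : ℝ) ^ 2 := by
  rw [torusXYStiffness_mul_partitionFnJ_eq_tsum_winding K 0]
  rfl

/-- `Z_L(K) = ∑_n W_K(n)`. [cite: FrohlichSpencerCMP1982, §2.3 (duality transformation)] -/
theorem partitionFnJ_eq_tsum_weight (K : ℝ) :
    (torusXY 2 L).partitionFnJ (fun _ => K) = ∑' n : TorusSite 2 L × Fin 2 → ℤ, currentWeight K n :=
  (torusXY 2 L).partitionFnJ_eq_tsum_currentWeight (fun _ => K)

/-- **High-temperature bound on the helicity modulus**: for `K ≥ 0` and every `L` with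
`ε₁ = L² ∑_{ℓ=L}^{2L²} (2K)^ℓ ≤ ¼`,
`βΥ_L(K) ≤ 4 · L² ∑_{ℓ=L}^{2L²} ℓ² (2K)^ℓ` — exponentially small in `L` for `K < ½`.
[cite: FriedliVelenik2017, §3.7.2 (Peierls argument); FrohlichPfister1983 Lemma 3.1 and Remark (pp. 307–308)] -/
theorem torusXYStiffness_le_of_peierls {K : ℝ} (hK : 0 ≤ K)
    (hε : (L : ℝ) ^ 2 * ∑ ℓ ∈ Finset.Icc L (2 * L ^ 2), (2 * K) ^ ℓ ≤ 1 / 4) :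
    torusXYStiffness L K ≤ 4 * ((L : ℝ) ^ 2 * ∑ ℓ ∈ Finset.Icc L (2 * L ^ 2), (ℓ : ℝ) ^ 2 * (2 * K) ^ ℓ) := by
  set S := ∑' n : TorusSite 2 L × Fin 2 → ℤ, currentWeight K n * (wind n : ℝ) ^ 2 with hS
  set Z := ∑' n : TorusSite 2 L × Fin 2 → ℤ, currentWeight K n with hZ
  set ε₂ := (L : ℝ) ^ 2 * ∑ ℓ ∈ Finset.Icc L (2 * L ^ 2), (ℓ : ℝ) ^ 2 * (2 * K) ^ ℓ with hε₂
  have hZpos : 0 < Z := by rw [hZ, ← partitionFnJ_eq_tsum_weight]; exact (torusXY 2 L).partitionFnJ_pos _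
  have hSZ : torusXYStiffness L K * Z = S := by
    rw [hZ, ← partitionFnJ_eq_tsum_weight]; exact torusXYStiffness_mul_partitionFnJ_eq_tsum_wind K
  have hS0 : 0 ≤ S := tsum_nonneg fun n => mul_nonneg (currentWeight_nonneg hK n) (sq_nonneg _)
  have hε₂0 : 0 ≤ ε₂ := mul_nonneg (sq_nonneg _) (Finset.sum_nonneg fun ℓ _ =>
    mul_nonneg (sq_nonneg _) (pow_nonneg (by linarith) _))
  have hren := renewal_inequality (L := L) hK
  have hS_le : S ≤ 4 * ε₂ * Z := by nlinarith
  have hst : torusXYStiffness L K = S / Z := by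
    rw [← hSZ, mul_div_cancel_right₀ _ hZpos.ne']
  rw [hst, div_le_iff₀ hZpos]
  linarith

/-! ### Explicit form at `K ≤ ¼` -/

omit [NeZero L] [MeasurableSpace Circle] [BorelSpace Circle] in
/-- `8L² ≤ 2^L` for `L ≥ 10`. [folklore] -/
private theorem eight_mul_sq_le_two_pow : ∀ {L : ℕ}, 10 ≤ L → 8 * L ^ 2 ≤ 2 ^ L := by
  intro L hL
  induction L with
  | zero => omega
  | succ m ih =>
    rcases Nat.lt_or_ge m 10 with hm | hm
    · interval_cases m <;> simp_all
    · have h := ih hm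
      have hm3 : 2 * m + 1 ≤ m ^ 2 := by nlinarith
      calc 8 * (m + 1) ^ 2 = 8 * m ^ 2 + (16 * m + 8) := by ring
        _ ≤ 8 * m ^ 2 + 8 * m ^ 2 := by nlinarith
        _ ≤ 2 ^ m + 2 ^ m := by omega
        _ = 2 ^ (m + 1) := by ring

omit [NeZero L] [MeasurableSpace Circle] [BorelSpace Circle] in
/-- The truncated geometric tail: `∑_{ℓ=L}^{M} r^ℓ ≤ 2 r^L` for `0 ≤ r ≤ ½`. [folklore] -/
private theorem sum_Icc_pow_le {r : ℝ} (hr0 : 0 ≤ r) (hr : r ≤ 1 / 2) (L M : ℕ) :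
    ∑ ℓ ∈ Finset.Icc L M, r ^ ℓ ≤ 2 * r ^ L := by
  rw [← Finset.Ico_add_one_right_eq_Icc]
  refine (geom_sum_Ico_le_of_lt_one hr0 (by linarith)).trans ?_
  rw [div_le_iff₀ (by linarith)]
  nlinarith [pow_nonneg hr0 L]

/-- **Explicit high-temperature bound**: for `0 ≤ K ≤ ¼` (temperature `T ≥ 4J`) and `L ≥ 10`,
`βΥ_L(K) ≤ 32·L⁶·(2K)^L` — exponentially small in the volume.
[cite: FriedliVelenik2017, §3.7.2 (Peierls argument); FrohlichPfister1983 Lemma 3.1 and Remark (pp. 307–308)] -/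
theorem torusXYStiffness_le_highTemperature {K : ℝ} (hK0 : 0 ≤ K) (hK : K ≤ 1 / 4) (hL : 10 ≤ L) :
    torusXYStiffness L K ≤ 32 * (L : ℝ) ^ 6 * (2 * K) ^ L := by
  have hr0 : 0 ≤ 2 * K := by linarith
  have hr : 2 * K ≤ 1 / 2 := by linarith
  have hL1 : (10 : ℝ) ≤ L := by exact_mod_cast hL
  have hgeo := sum_Icc_pow_le hr0 hr L (2 * L ^ 2)
  have hpowL : (2 * K) ^ L ≤ (1 / 2) ^ L := pow_le_pow_left₀ hr0 hr L
  have h82 : 8 * (L : ℝ) ^ 2 ≤ 2 ^ L := by exact_mod_cast eight_mul_sq_le_two_pow hL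
  have hhalf : ((1 : ℝ) / 2) ^ L * 2 ^ L = 1 := by rw [← mul_pow]; norm_num
  -- ε₁ ≤ ¼
  have hε : (L : ℝ) ^ 2 * ∑ ℓ ∈ Finset.Icc L (2 * L ^ 2), (2 * K) ^ ℓ ≤ 1 / 4 := by
    calc (L : ℝ) ^ 2 * ∑ ℓ ∈ Finset.Icc L (2 * L ^ 2), (2 * K) ^ ℓ ≤ (L : ℝ) ^ 2 * (2 * (2 * K) ^ L) :=
          mul_le_mul_of_nonneg_left hgeo (sq_nonneg _)
      _ ≤ (L : ℝ) ^ 2 * (2 * (1 / 2) ^ L) := by gcongr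
      _ ≤ 1 / 4 := by nlinarith [pow_nonneg (by norm_num : (0 : ℝ) ≤ 1 / 2) L]
  refine (torusXYStiffness_le_of_peierls hK0 hε).trans ?_
  -- ε₂ ≤ 8 L⁶ (2K)^L
  calc 4 * ((L : ℝ) ^ 2 * ∑ ℓ ∈ Finset.Icc L (2 * L ^ 2), (ℓ : ℝ) ^ 2 * (2 * K) ^ ℓ)
      ≤ 4 * ((L : ℝ) ^ 2 * ∑ ℓ ∈ Finset.Icc L (2 * L ^ 2), (2 * (L : ℝ) ^ 2) ^ 2 * (2 * K) ^ ℓ) := by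
        gcongr with ℓ hmem
        exact_mod_cast (Finset.mem_Icc.1 hmem).2
    _ = 16 * (L : ℝ) ^ 6 * ∑ ℓ ∈ Finset.Icc L (2 * L ^ 2), (2 * K) ^ ℓ := by
        rw [← Finset.mul_sum]; ring
    _ ≤ 16 * (L : ℝ) ^ 6 * (2 * (2 * K) ^ L) := by gcongr
    _ = 32 * (L : ℝ) ^ 6 * (2 * K) ^ L := by ring

/-- **The helicity modulus vanishes in the thermodynamic limit at high temperature**:
`βΥ_L(K) → 0` as `L → ∞` for `0 ≤ K ≤ ¼` — the lower end of the stiffness window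
`0 ≤ βΥ_L(K) ≤ 8K²/(1+8K)` is attained in the limit, so a stiffness-window hypothesis `Υ_L/J ≥ y₀ > 0`
(the typing rule of `torusXY_not_uniform_decay_of_tendsto`) fails at high temperature.
[cite: FriedliVelenik2017, §3.7.2 (Peierls argument); FrohlichPfister1983 Lemma 3.1 and Remark (pp. 307–308)] -/
theorem tendsto_torusXYStiffness_highTemperature {K : ℝ} (hK0 : 0 ≤ K) (hK : K ≤ 1 / 4) :
    Tendsto (fun L : ℕ => torusXYStiffness (L + 1) K) atTop (𝓝 0) := by
  have hr : |2 * K| < 1 := by rw [abs_of_nonneg (by linarith)]; linarith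
  -- the majorant `32 (L+1)^6 (2K)^{L+1} → 0`
  have hmaj : Tendsto (fun L : ℕ => 32 * ((L + 1 : ℕ) : ℝ) ^ 6 * (2 * K) ^ (L + 1)) atTop (𝓝 0) := by
    have h := (tendsto_pow_const_mul_const_pow_of_abs_lt_one 6 hr).comp (tendsto_add_atTop_nat 1)
    have h' := h.const_mul 32
    rw [mul_zero] at h'
    refine h'.congr fun L => ?_
    simp only [Function.comp_apply]
    ring
  refine tendsto_of_tendsto_of_tendsto_of_le_of_le' tendsto_const_nhds hmaj ?_ ?_
  · exact Eventually.of_forall fun L => torusXYStiffness_nonneg hK0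
  · filter_upwards [eventually_ge_atTop 9] with L hL
    have h := torusXYStiffness_le_highTemperature (L := L + 1) hK0 hK (by omega)
    exact_mod_cast h

/-- **The helicity modulus vanishes in the thermodynamic limit for every `K < ½`** (`T > 2J`):
`βΥ_L(K) → 0` as `L → ∞`. For `r = 2K < 1` the entropy factor `ε₁ = L²∑_{ℓ=L}^{2L²} r^ℓ ≤ L² r^L/(1−r)`
is eventually `≤ ¼`, and then `βΥ_L ≤ 4ε₂ ≤ 16 L⁶ r^L/(1−r) → 0`.
[cite: FriedliVelenik2017, §3.7.2 (Peierls argument); FrohlichPfister1983 Lemma 3.1 and Remark (pp. 307–308)] -/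
theorem tendsto_torusXYStiffness_of_lt_half {K : ℝ} (hK0 : 0 ≤ K) (hK : K < 1 / 2) :
    Tendsto (fun L : ℕ => torusXYStiffness (L + 1) K) atTop (𝓝 0) := by
  set r : ℝ := 2 * K with hr
  have hr0 : 0 ≤ r := by rw [hr]; linarith
  have hr1 : r < 1 := by rw [hr]; linarith
  have hrabs : |r| < 1 := by rw [abs_of_nonneg hr0]; exact hr1
  have h1r : 0 < 1 - r := by linarith
  -- geometric tail on the shifted index
  have hgeo : ∀ L : ℕ, ∑ ℓ ∈ Finset.Icc L (2 * L ^ 2), r ^ ℓ ≤ r ^ L / (1 - r) := fun L => by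
    rw [← Finset.Ico_add_one_right_eq_Icc]
    exact geom_sum_Ico_le_of_lt_one hr0 hr1
  -- the entropy factor tends to zero, hence is eventually ≤ ¼
  have hε : Tendsto (fun L : ℕ => ((L + 1 : ℕ) : ℝ) ^ 2 * (r ^ (L + 1) / (1 - r))) atTop (𝓝 0) := by
    have h := ((tendsto_pow_const_mul_const_pow_of_abs_lt_one 2 hrabs).comp
      (tendsto_add_atTop_nat 1)).div_const (1 - r)
    rw [zero_div] at h
    refine h.congr fun L => ?_
    simp only [Function.comp_apply]
    ring
  have hεev : ∀ᶠ L : ℕ in atTop, ((L + 1 : ℕ) : ℝ) ^ 2 * (r ^ (L + 1) / (1 - r)) ≤ 1 / 4 :=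
    (hε.eventually (ge_mem_nhds (by norm_num : (0 : ℝ) < 1 / 4)))
  -- the majorant tends to zero
  have hmaj : Tendsto (fun L : ℕ => 16 * ((L + 1 : ℕ) : ℝ) ^ 6 * (r ^ (L + 1) / (1 - r))) atTop (𝓝 0) := by
    have h := (((tendsto_pow_const_mul_const_pow_of_abs_lt_one 6 hrabs).comp
      (tendsto_add_atTop_nat 1)).div_const (1 - r)).const_mul 16
    rw [zero_div, mul_zero] at h
    refine h.congr fun L => ?_
    simp only [Function.comp_apply]
    ring
  refine tendsto_of_tendsto_of_tendsto_of_le_of_le' tendsto_const_nhds hmaj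
    (Eventually.of_forall fun L => torusXYStiffness_nonneg hK0) ?_
  filter_upwards [hεev] with L hL
  have hε1 : ((L + 1 : ℕ) : ℝ) ^ 2 * ∑ ℓ ∈ Finset.Icc (L + 1) (2 * (L + 1) ^ 2), (2 * K) ^ ℓ ≤ 1 / 4 :=
    (mul_le_mul_of_nonneg_left (hgeo (L + 1)) (sq_nonneg _)).trans hL
  refine (torusXYStiffness_le_of_peierls (L := L + 1) hK0 hε1).trans ?_
  calc 4 * (((L + 1 : ℕ) : ℝ) ^ 2 * ∑ ℓ ∈ Finset.Icc (L + 1) (2 * (L + 1) ^ 2), (ℓ : ℝ) ^ 2 * (2 * K) ^ ℓ)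
      ≤ 4 * (((L + 1 : ℕ) : ℝ) ^ 2 * ∑ ℓ ∈ Finset.Icc (L + 1) (2 * (L + 1) ^ 2),
          (2 * ((L + 1 : ℕ) : ℝ) ^ 2) ^ 2 * (2 * K) ^ ℓ) := by
        gcongr with ℓ hmem
        exact_mod_cast (Finset.mem_Icc.1 hmem).2
    _ = 16 * ((L + 1 : ℕ) : ℝ) ^ 6 * ∑ ℓ ∈ Finset.Icc (L + 1) (2 * (L + 1) ^ 2), r ^ ℓ := by
        rw [← Finset.mul_sum, hr]; ring
    _ ≤ 16 * ((L + 1 : ℕ) : ℝ) ^ 6 * (r ^ (L + 1) / (1 - r)) := by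
        gcongr
        exact hgeo (L + 1)

end HighTemperature

end Literature.Probability.LatticeModels
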